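import Summits.RiemannHypothesis.RiemannHypothesis.Theorems.SignConeCondRungMollifier
import Summits.RiemannHypothesis.RiemannHypothesis.Theorems.SignConeCondRungLowFreq
import Literature.NumberTheory.LFunctions.WeilArchimedeanMoments

/-!
# Route SignCone — conditional rungs, IV: the conditional unit-slack theorem (Theorem A, abstract form)

Items stmt-RiemannHypothesis-16301/16302 (evidence `RUNG-STRUCTURE.md` on 16302). **Theorem A.** Let every zero of
`ζ` with `|Im ρ| ≤ H` lie on the critical line (`RiemannHypothesisInStripUpTo H`), let `Fplus` be a slack density at
cutoff `b′` — `Re W(u ⋆ ũ) + ‖u‖₂² = (1/2π) ∫ |û(½+iy)|² Fplus(y) dy` for every Weil test `u` supported in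
`[-b′, b′]` (`IsSlackDensity`; supplied by the pointwise-certificate identity files with honest weights `Λ`) —
with `Fplus ≥ κ` beyond `|y| > Y₂` (high frequencies: digamma growth beats the SOS-bounded comb) and `Fplus ≥ −B`
below. If the mollifier parameters `h, m` (`b + 2(m+1)h ≤ b′`, `hY₂ ≤ 1`) satisfy the two numerical conditions
`τ + δ(1+B) ≤ 1`, `τ ≤ κ ≤ 1` with `δ = (2m+2)(hY₂)²/3` and
`τ = 2b e^{b} (cosh(h/2)/h)^{4(m+1)} H^{2−4(m+1)} Θ` (`Θ ≥ Σ_{|Im ρ|>H} m(ρ)/(Im ρ)²`), then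
`−‖g‖₂² ≤ Re W(g ⋆ g̃)` for every Weil test `g` supported in `[-b, b]` (`unitSlackWeil_of_rhUpTo`): Weil's
quadratic functional with UNIT SLACK at cutoff `b`, i.e. the fake-weight inequality with the honest weights
`c = Λ`, whence the sign-cone items up to cutoff `b` (`SignConeUnitSlackReduction`).
Proof: `g_L = g ⋆ φ` (`φ = crMoll h m`), `|ĝ_L|² = |ĝ|² w`, `w = sinc(yh)^{4(m+1)} ∈ [0,1]`, `1 − w ≤ δ` on `|y| ≤ Y₂`;
`Re W(g_L ⋆ g̃_L) ≥ −τ‖g‖²` (`re_weilFunctional_ge_of_rhUpTo` with the strip decay of `φ̂`); and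
`Re W(G) + ‖g‖² = (1/2π)∫|ĝ|²[(1−w)Fplus + w] + Re W(G_L) ≥ (1/2π)∫|ĝ|²[(1−w)Fplus + w − τ] ≥ 0` pointwise.
-/

noncomputable section

-- `Summit.RiemannHypothesis.RiemannHypothesis.…` repeats a namespace component by design (D-0017 layout).
set_option linter.dupNamespace false

open scoped BigOperators ComplexConjugate Real Topology
open Complex MeasureTheory Set Filter

namespace Summit.RiemannHypothesis.RiemannHypothesis.Theorems.SignCone

open Literature.NumberTheory.LFunctions
open Literature.NumberTheory.LFunctions.ZetaZeroTails (tailInvImSq tailInvImSq_nonneg)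

/-- **Slack densities.** `Fplus` represents the unit-slack Weil functional spectrally at cutoff `b′`:
for every Weil test `u` supported in `[-b′, b′]`, `y ↦ |û(½+iy)|² Fplus(y)` is integrable and
`Re W(u ⋆ ũ) + ‖u‖₂² = (1/2π) ∫ |û(½+iy)|² Fplus(y) dy`. [folklore] -/
def IsSlackDensity (b' : ℝ) (Fplus : ℝ → ℝ) : Prop :=
  ∀ u : ℝ → ℂ, IsWeilTest u → tsupport u ⊆ Icc (-b') b' →
    Integrable (fun y : ℝ => ‖weilMellin u (1 / 2 + y * I)‖ ^ 2 * Fplus y) ∧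
    (weilFunctional (weilConv u (weilReflect u))).re + weilNorm2Sq u =
      1 / (2 * π) * ∫ y : ℝ, ‖weilMellin u (1 / 2 + y * I)‖ ^ 2 * Fplus y

section Mollified

variable {g : ℝ → ℂ} (hg : IsWeilTest g) {b : ℝ} (hb : 0 < b) (hsupp : tsupport g ⊆ Icc (-b) b)
  {h : ℝ} (hh : 0 < h) (m : ℕ)
include hg hh

/-- The mollified test `g ⋆ φ`, `φ = crMoll h m`, is a Weil test. [folklore] -/
theorem isWeilTest_weilConv_crMoll : IsWeilTest (weilConv g (crMoll h m)) := by
  refine ⟨?_, ?_⟩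
  · rw [weilConv_eq_convolution_real]
    exact hg.2.contDiff_convolution_left _ hg.1 (continuous_crMoll hh m).locallyIntegrable
  · rw [weilConv_eq_convolution_real]
    exact hg.2.convolution _ (hasCompactSupport_crMoll hh m)

include hsupp in
/-- `tsupport (g ⋆ φ) ⊆ [-(b + 2(m+1)h), b + 2(m+1)h]`. [folklore] -/
theorem tsupport_weilConv_crMoll_subset :
    tsupport (weilConv g (crMoll h m)) ⊆ Icc (-(b + 2 * (m + 1) * h)) (b + 2 * (m + 1) * h) := by
  refine (tsupport_weilConv_subset hg.2).trans ?_
  rintro x ⟨u, hu, v, hv, rfl⟩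
  have hu' := hsupp hu
  have hv' := tsupport_crMoll_subset hh m hv
  simp only [mem_Icc] at hu' hv' ⊢
  constructor <;> linarith

/-- `(g ⋆ φ)^(s) = ĝ(s) · sinhc((s-½)h)^{2(m+1)}`. [folklore] -/
theorem weilMellin_weilConv_crMoll (s : ℂ) :
    weilMellin (weilConv g (crMoll h m)) s = weilMellin g s * sinhc ((s - 1 / 2) * h) ^ (2 * (m + 1)) := by
  rw [weilMellin_weilConv_holds hg.1.continuous hg.2 (continuous_crMoll hh m) (hasCompactSupport_crMoll hh m),
    weilMellin_crMoll hh]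

/-- On the critical line `|(g ⋆ φ)^(½+iy)|² = |ĝ(½+iy)|² · sinc(yh)^{4(m+1)}`. [folklore] -/
theorem norm_sq_weilMellin_weilConv_crMoll (y : ℝ) :
    ‖weilMellin (weilConv g (crMoll h m)) (1 / 2 + y * I)‖ ^ 2 =
      ‖weilMellin g (1 / 2 + y * I)‖ ^ 2 * Real.sinc (y * h) ^ (4 * (m + 1)) := by
  rw [weilMellin_weilConv_holds hg.1.continuous hg.2 (continuous_crMoll hh m) (hasCompactSupport_crMoll hh m),
    norm_mul, mul_pow, (norm_weilMellin_crMoll_half_line hh y m).1, ← pow_mul]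
  ring_nf

include hb hsupp in
/-- **Strip decay of the mollified autocorrelation**: at a point `ρ = β + iγ` of the open critical strip,
`‖(g_L ⋆ g̃_L)^(ρ)‖ ≤ 2b e^{b} ‖g‖₂² (cosh(h/2)/h)^{4(m+1)} / |γ|^{4(m+1)}`. [folklore] -/
theorem norm_weilMellin_mollified_quadratic_le {ρ : ℂ} (h0 : 0 < ρ.re) (h1 : ρ.re < 1) (hγ : ρ.im ≠ 0) :
    ‖weilMellin (weilConv (weilConv g (crMoll h m)) (weilReflect (weilConv g (crMoll h m)))) ρ‖ ≤
      2 * b * Real.exp b * weilNorm2Sq g * (Real.cosh (h / 2) / h) ^ (4 * (m + 1)) / |ρ.im| ^ (4 * (m + 1)) := by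
  have hgL := isWeilTest_weilConv_crMoll hg hh m
  rw [weilMellin_weilQuadratic hgL, norm_mul, Complex.norm_conj, weilMellin_weilConv_crMoll hg hh m,
    weilMellin_weilConv_crMoll hg hh m, norm_mul, norm_mul]
  -- the two `ĝ` factors
  have hρ : ρ = (ρ - 1 / 2) + 1 / 2 := by ring
  have hρ' : (1 - conj ρ) = (1 / 2 - conj ρ) + 1 / 2 := by ring
  have e1 : ‖weilMellin g ρ‖ ≤ Real.exp (b / 2) * weilNorm1 g := by
    rw [hρ]
    refine (norm_weilMellin_add_half_le hg hsupp _).trans (mul_le_mul_of_nonneg_right ?_ (weilNorm1_nonneg g))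
    rw [Real.exp_le_exp, show (ρ - 1 / 2 : ℂ).re = ρ.re - 1 / 2 by simp]
    have : |ρ.re - 1 / 2| ≤ 1 / 2 := abs_le.2 ⟨by linarith, by linarith⟩
    nlinarith
  have e2 : ‖weilMellin g (1 - conj ρ)‖ ≤ Real.exp (b / 2) * weilNorm1 g := by
    rw [hρ']
    refine (norm_weilMellin_add_half_le hg hsupp _).trans (mul_le_mul_of_nonneg_right ?_ (weilNorm1_nonneg g))
    rw [Real.exp_le_exp, show (1 / 2 - conj ρ : ℂ).re = 1 / 2 - ρ.re by simp]
    have : |1 / 2 - ρ.re| ≤ 1 / 2 := abs_le.2 ⟨by linarith, by linarith⟩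
    nlinarith
  -- the two mollifier factors
  have hc : ∀ β : ℝ, |β - 1 / 2| ≤ 1 / 2 → Real.cosh ((β - 1 / 2) * h) ≤ Real.cosh (h / 2) := by
    intro β hβ
    rw [Real.cosh_le_cosh, abs_mul, abs_of_pos hh]
    have : |h / 2| = h / 2 := abs_of_pos (by linarith)
    rw [this]
    nlinarith
  have hγpos : 0 < |ρ.im| := abs_pos.2 hγ
  have f1 : ‖sinhc ((ρ - 1 / 2) * h) ^ (2 * (m + 1))‖ ≤ (Real.cosh (h / 2) / (|ρ.im| * h)) ^ (2 * (m + 1)) := by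
    have e : ρ = (ρ.re : ℂ) + (ρ.im : ℂ) * I := (Complex.re_add_im ρ).symm
    have := norm_weilMellin_crMoll_le hh (β := ρ.re) hγ m
    rw [← e, weilMellin_crMoll hh] at this
    refine this.trans (pow_le_pow_left₀ (by positivity) ?_ _)
    exact div_le_div_of_nonneg_right (hc ρ.re (abs_le.2 ⟨by linarith, by linarith⟩)) (by positivity)
  have f2 : ‖sinhc ((1 - conj ρ - 1 / 2) * h) ^ (2 * (m + 1))‖ ≤ (Real.cosh (h / 2) / (|ρ.im| * h)) ^ (2 * (m + 1)) := by
    have e : (1 - conj ρ) = ((1 - ρ.re : ℝ) : ℂ) + (ρ.im : ℂ) * I := by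
      apply Complex.ext <;> simp
    have := norm_weilMellin_crMoll_le hh (β := 1 - ρ.re) hγ m
    rw [← e, weilMellin_crMoll hh] at this
    refine this.trans (pow_le_pow_left₀ (by positivity) ?_ _)
    refine div_le_div_of_nonneg_right ?_ (by positivity)
    have := hc (1 - ρ.re) (abs_le.2 ⟨by linarith, by linarith⟩)
    rwa [show (1 - ρ.re - 1 / 2) = -(ρ.re - 1 / 2) by ring, neg_mul, Real.cosh_neg] at this ⊢
  -- assemble
  have hL1 : weilNorm1 g ^ 2 ≤ 2 * b * weilNorm2Sq g := weilNorm1_sq_le hg hb hsupp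
  have hpow : (Real.cosh (h / 2) / (|ρ.im| * h)) ^ (2 * (m + 1)) * (Real.cosh (h / 2) / (|ρ.im| * h)) ^ (2 * (m + 1)) =
      (Real.cosh (h / 2) / h) ^ (4 * (m + 1)) / |ρ.im| ^ (4 * (m + 1)) := by
    rw [← pow_add, show 2 * (m + 1) + 2 * (m + 1) = 4 * (m + 1) by ring,
      show Real.cosh (h / 2) / (|ρ.im| * h) = Real.cosh (h / 2) / h / |ρ.im| by rw [div_div, mul_comm], div_pow]
  have hA : 0 ≤ Real.exp (b / 2) * weilNorm1 g := mul_nonneg (Real.exp_pos _).le (weilNorm1_nonneg g)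
  have hCp : 0 ≤ (Real.cosh (h / 2) / (|ρ.im| * h)) ^ (2 * (m + 1)) := by positivity
  calc ‖weilMellin g ρ‖ * ‖sinhc ((ρ - 1 / 2) * ↑h) ^ (2 * (m + 1))‖ *
        (‖weilMellin g (1 - conj ρ)‖ * ‖sinhc ((1 - conj ρ - 1 / 2) * ↑h) ^ (2 * (m + 1))‖)
      ≤ (Real.exp (b / 2) * weilNorm1 g) * (Real.cosh (h / 2) / (|ρ.im| * h)) ^ (2 * (m + 1)) *
        ((Real.exp (b / 2) * weilNorm1 g) * (Real.cosh (h / 2) / (|ρ.im| * h)) ^ (2 * (m + 1))) :=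
        mul_le_mul (mul_le_mul e1 f1 (norm_nonneg _) hA) (mul_le_mul e2 f2 (norm_nonneg _) hA)
          (mul_nonneg (norm_nonneg _) (norm_nonneg _)) (mul_nonneg hA hCp)
    _ = Real.exp (b / 2) ^ 2 * weilNorm1 g ^ 2 * ((Real.cosh (h / 2) / (|ρ.im| * h)) ^ (2 * (m + 1)) *
          (Real.cosh (h / 2) / (|ρ.im| * h)) ^ (2 * (m + 1))) := by ring
    _ ≤ Real.exp (b / 2) ^ 2 * (2 * b * weilNorm2Sq g) * ((Real.cosh (h / 2) / (|ρ.im| * h)) ^ (2 * (m + 1)) *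
          (Real.cosh (h / 2) / (|ρ.im| * h)) ^ (2 * (m + 1))) :=
        mul_le_mul_of_nonneg_right (mul_le_mul_of_nonneg_left hL1 (sq_nonneg _)) (mul_nonneg hCp hCp)
    _ = 2 * b * Real.exp b * weilNorm2Sq g * (Real.cosh (h / 2) / h) ^ (4 * (m + 1)) / |ρ.im| ^ (4 * (m + 1)) := by
        rw [hpow, ← Real.exp_nat_mul]; ring_nf

end Mollified

/-! ### Theorem A -/

section TheoremA

variable {g : ℝ → ℂ} (hg : IsWeilTest g) {b : ℝ} (hb : 0 < b) (hsupp : tsupport g ⊆ Icc (-b) b)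
  {h : ℝ} (hh : 0 < h) {m : ℕ} {b' : ℝ} (hbb : b + 2 * (m + 1) * h ≤ b')
  {H Θ : ℝ} (hH : 1 ≤ H) (hRH : RiemannHypothesisInStripUpTo H) (hΘ : tailInvImSq H ≤ Θ)
  {Fplus : ℝ → ℝ} (hF : IsSlackDensity b' Fplus)
  {Y₂ κ B : ℝ} (hY : 0 ≤ Y₂) (hhY : h * Y₂ ≤ 1) (hκ1 : κ ≤ 1) (hB : 0 ≤ B)
  (hHF : ∀ y : ℝ, Y₂ < |y| → κ ≤ Fplus y) (hLB : ∀ y : ℝ, |y| ≤ Y₂ → -B ≤ Fplus y)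
  (hN1 : 2 * b * Real.exp b * (Real.cosh (h / 2) / h) ^ (4 * (m + 1)) / H ^ (4 * (m + 1) - 2) * Θ +
      (2 * m + 2) * (h * Y₂) ^ 2 / 3 * (1 + B) ≤ 1)
  (hN2 : 2 * b * Real.exp b * (Real.cosh (h / 2) / h) ^ (4 * (m + 1)) / H ^ (4 * (m + 1) - 2) * Θ ≤ κ)
include hg hb hsupp hh hbb hH hRH hΘ hF hY hhY hκ1 hB hHF hLB hN1 hN2

/-- **Theorem A — Weil's functional with unit slack from numerical RH** (abstract form): under
`RiemannHypothesisInStripUpTo H`, a slack density `Fplus` at cutoff `b′ ≥ b + 2(m+1)h` with `Fplus ≥ κ` for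
`|y| > Y₂` and `Fplus ≥ −B` for `|y| ≤ Y₂`, and the two numerical side conditions on `(b, h, m, H, Θ, Y₂, κ, B)`,
every Weil test `g` supported in `[-b, b]` satisfies `−‖g‖₂² ≤ Re W(g ⋆ g̃)`. [folklore] -/
theorem unitSlackWeil_of_rhUpTo : -weilNorm2Sq g ≤ (weilFunctional (weilConv g (weilReflect g))).re := by
  -- notation
  set τc : ℝ := 2 * b * Real.exp b * (Real.cosh (h / 2) / h) ^ (4 * (m + 1)) / H ^ (4 * (m + 1) - 2) * Θ with hτc
  set δ : ℝ := (2 * m + 2) * (h * Y₂) ^ 2 / 3 with hδ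
  set gL : ℝ → ℂ := weilConv g (crMoll h m) with hgL_def
  have hgL : IsWeilTest gL := isWeilTest_weilConv_crMoll hg hh m
  have hgLs : tsupport gL ⊆ Icc (-b') b' :=
    (tsupport_weilConv_crMoll_subset hg hsupp hh m).trans (Icc_subset_Icc (by linarith) hbb)
  have hgs' : tsupport g ⊆ Icc (-b') b' := hsupp.trans (Icc_subset_Icc (by nlinarith) (by nlinarith))
  obtain ⟨hIg, hSg⟩ := hF g hg hgs'
  obtain ⟨hIgL, hSgL⟩ := hF gL hgL hgLs
  set ρ : ℝ → ℝ := fun y => ‖weilMellin g (1 / 2 + y * I)‖ ^ 2 with hρ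
  set w : ℝ → ℝ := fun y => Real.sinc (y * h) ^ (4 * (m + 1)) with hw
  have hw01 : ∀ y, 0 ≤ w y ∧ w y ≤ 1 := fun y => by
    have e : 4 * (m + 1) = 2 * (2 * m + 1 + 1) := by ring
    simp only [hw, e]
    refine ⟨by rw [pow_mul]; positivity, ?_⟩
    rw [pow_mul]
    exact pow_le_one₀ (sq_nonneg _) (by rw [sq_le_one_iff_abs_le_one]; exact Real.abs_sinc_le_one _)
  have hwflat : ∀ y, |y| ≤ Y₂ → 1 - w y ≤ δ := fun y hy => by
    have e : 4 * (m + 1) = 2 * (2 * m + 1 + 1) := by ring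
    have hu : |y * h| ≤ 1 := by
      rw [abs_mul, abs_of_pos hh]
      calc |y| * h ≤ Y₂ * h := mul_le_mul_of_nonneg_right hy hh.le
        _ ≤ 1 := by linarith [mul_comm h Y₂]
    simp only [hw, e]
    refine (one_sub_sinc_pow_le hu (2 * m + 1)).trans ?_
    simp only [hδ]
    push_cast
    have : (y * h) ^ 2 ≤ (h * Y₂) ^ 2 := by
      rw [← sq_abs (y * h), ← sq_abs (h * Y₂)]
      refine pow_le_pow_left₀ (abs_nonneg _) ?_ 2
      rw [abs_mul, abs_mul, abs_of_pos hh, abs_of_nonneg hY]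
      nlinarith [abs_nonneg y]
    nlinarith
  have hρL : ∀ y : ℝ, ‖weilMellin gL (1 / 2 + y * I)‖ ^ 2 = ρ y * w y := fun y =>
    norm_sq_weilMellin_weilConv_crMoll hg hh m y
  -- the four spectral quantities (`set` has folded `ρ` into `hIg`, `hSg`)
  have hPl : weilNorm2Sq g = 1 / (2 * π) * ∫ y, ρ y := by
    rw [hρ, integral_norm_sq_weilMellin_half_line hg]; field_simp
  have hPlL : weilNorm2Sq gL = 1 / (2 * π) * ∫ y, ρ y * w y := by
    have := integral_norm_sq_weilMellin_half_line hgL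
    simp only [hρL] at this
    rw [this]; field_simp
  simp only [hρL] at hIgL hSgL
  -- low frequencies
  set Kc : ℝ := 2 * b * Real.exp b * weilNorm2Sq g * (Real.cosh (h / 2) / h) ^ (4 * (m + 1)) with hKc
  have hK0 : 0 ≤ Kc := by have := weilNorm2Sq_nonneg g; positivity
  have hτK : τc * weilNorm2Sq g = Kc / H ^ (4 * (m + 1) - 2) * Θ := by rw [hτc, hKc]; ring
  have hlow : -(τc * weilNorm2Sq g) ≤ (weilFunctional (weilConv gL (weilReflect gL))).re := by
    have hk : 2 ≤ 4 * (m + 1) := by omega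
    have hlf := re_weilFunctional_ge_of_rhUpTo hgL hH hRH hK0 hk (fun z hz h0 h1 hzH =>
      norm_weilMellin_mollified_quadratic_le hg hb hsupp hh m h0 h1 (fun him => by
        rw [him, abs_zero] at hzH; linarith))
    refine le_trans ?_ hlf
    rw [hτK, neg_le_neg_iff]
    exact mul_le_mul_of_nonneg_left hΘ (by positivity)
  -- integrability bookkeeping
  have hI1 : Integrable ρ := integrable_norm_sq_weilMellin_half_line hg
  have hI2 : Integrable fun y => ρ y * w y := by
    have := integrable_norm_sq_weilMellin_half_line hgL
    simpa only [hρL] using this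
  have h12 : Integrable fun y => ρ y * Fplus y - ρ y * w y * Fplus y := hIg.sub hIgL
  have h123 : Integrable fun y => ρ y * Fplus y - ρ y * w y * Fplus y + ρ y * w y := h12.add hI2
  have h4 : Integrable fun y => τc * ρ y := hI1.const_mul τc
  -- pointwise lower bound of the combined density
  have hpt : ∀ y, 0 ≤ ρ y * ((1 - w y) * Fplus y + w y - τc) := by
    intro y
    refine mul_nonneg (sq_nonneg _) ?_
    obtain ⟨hw0, hw1⟩ := hw01 y
    have h1w : 0 ≤ 1 - w y := sub_nonneg.2 hw1
    rcases le_or_gt |y| Y₂ with hy | hy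
    · have h1 := hwflat y hy
      have p1 := mul_le_mul_of_nonneg_left (hLB y hy) h1w
      have p2 := mul_le_mul_of_nonneg_right h1 hB
      have hδ0 : 0 ≤ δ := by positivity
      linarith
    · have p1 := mul_le_mul_of_nonneg_left (hHF y hy) h1w
      have p3 := mul_nonneg hw0 (sub_nonneg.2 hκ1)
      nlinarith [p1, p3]
  have e : (fun y => ρ y * ((1 - w y) * Fplus y + w y - τc)) =
      fun y => ρ y * Fplus y - ρ y * w y * Fplus y + ρ y * w y - τc * ρ y := by
    funext y; ring
  have hmain : 0 ≤ ∫ y, ρ y * Fplus y - ρ y * w y * Fplus y + ρ y * w y - τc * ρ y := by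
    rw [← e]; exact integral_nonneg hpt
  rw [integral_sub h123 h4, integral_add h12 hI2, integral_sub hIg hIgL, integral_const_mul] at hmain
  -- combine
  set IA := ∫ y, ρ y * Fplus y with hIA
  set IB := ∫ y, ρ y * w y * Fplus y with hIB
  set IC := ∫ y, ρ y * w y with hIC
  set Iρ := ∫ y, ρ y with hIρ
  set c : ℝ := 1 / (2 * π) with hc
  have hcpos : 0 < c := by positivity
  have hm2 : 0 ≤ c * IA - c * IB + c * IC - τc * (c * Iρ) := by
    have e2 : c * (IA - IB + IC - τc * Iρ) = c * IA - c * IB + c * IC - τc * (c * Iρ) := by ring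
    rw [← e2]; exact mul_nonneg hcpos.le hmain
  have eL : (weilFunctional (weilConv gL (weilReflect gL))).re = c * IB - c * IC := by linarith
  rw [eL] at hlow
  rw [hPl] at hlow ⊢
  linarith

end TheoremA

end Summit.RiemannHypothesis.RiemannHypothesis.Theorems.SignCone

end
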